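import Summits.ValiantsHypothesis.ValiantsHypothesis.Theorems.ValuativeGCTValuativeFlipTwistPositivityTransfer
import Summits.ValiantsHypothesis.ValiantsHypothesis.Theorems.ValuativeGCTValuativeFlipBorderInnerTransfer
import HarnessLib

/-!
# Fresh-padding inheritance: `mult_{λ*} ℂ[Δ_m(p)] ≤ mult_{(λ♯)*} ℂ[Δ_{m+j}(q)]` whenever `q` degenerates to a
# FRESH padding `X_y^j · ι(p)` of `p` (crux `ValuativeGCT.ValuativeFlip`, stmt-ValiantsHypothesis-12624;
# wall-breaker k12, axis "representation-stability transfer between `m` and `m + 1`"; helper file `--supports`)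

The every-`j` transfer along closure points (`orbitMultiplicity_le_rowLift_of_closurePoints`, twist
positivity, k12 gen 1) asks for the padded points `X_top^j · ι(A · p) ∈ Δ_{m+j}(q)` for ALL matrices
`A`, where `ι = segEmb` places the `m²` variables on the final segment and `X_top = ι(top)` is NOT a
fresh letter.  This file packages the hypothesis in the form every application actually meets:

* `exists_linSubst_fresh_padding` / `exists_linSubst_fresh_to_top`: if `y` is a variable of level
  `m + j` OFF the segment, then for every `A` some `End`-element sends `X_y^j · ι(p)` to
  `X_y^j · ι(A · p)` (act by `A` on the segment, fix `y`), and another sends `X_y^j · ι(g)` to the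
  engine's `X_top^j · ι(g)` (`y ↦ X_top`, everything else fixed) — both impossible with `y = X_top`,
  which is a segment variable;
* `orbitMultiplicity_le_rowLift_of_fresh_padding_mem` (**the tool**): `p` a form of degree `m`,
  `q ≠ 0` a form of degree `m + j`, `y ∉ ι(MatIdx m)` and `X_y^j · ι(p) ∈ Δ_{m+j}(q)` imply
  `mult_{λ*} ℂ[Δ_m(p)] ≤ mult_{(λ♯(m+j))*} ℂ[Δ_{m+j}(q)]` for every `λ ⊢ m·δ` with at most `m²` parts;
* `orbitMultiplicity_le_rowLift_fresh_padding` (**BLMW 2011 Problem 6.10 "≥" for fresh letters, every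
  form, every step**): `mult_{λ*} ℂ[Δ_m(p)] ≤ mult_{(λ♯)*} ℂ[Δ_{m+j}(X_y^j · ι(p))]` for `p ≠ 0` and `y`
  off the segment — the statement of this seat's predecessor's Theorem A (`TwistPositivityK12G1.md` §0)
  as one Lean theorem; what fails is only the SAME-letter step (`padding_step_monotonicity_fails`:
  `Δ(x^{j+1} g) ⊊ Δ(x^j · w · g)`);
* `exists_fresh_of_pos`: for `j ≥ 1` the variable `X₀₀` of level `m + j` is off the segment, so a
  fresh letter always exists.

The diagonal inheritance of `…DiagonalInheritance` (`X₀₀^{m-n} per_{n+j} ↝ X₀₀^j · ι(X₀₀^{m-n} per_n)`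
by a partial renaming), the determinant at every step (`det_everyStepMonotone`) and per-anchor
inheritance (`perAnchorInheritance_every`) are all instances of the tool.

Sources: BLMW, SIAM J. Comput. 40 (2011) §6.4 Problem 6.10; Bürgisser–Ikenmeyer–Panova, J. AMS 32 (2019)
§1(a) ("padding with a variable not appearing in `per_m` … is irrelevant"), §5; Ikenmeyer–Panova 2017
§7; Mulmuley–Sohoni 2001 §4.  No new definitions.
-/

set_option linter.dupNamespace false

namespace Summit.ValiantsHypothesis.ValiantsHypothesis.Theorems.ValuativeFlip

open scoped BigOperators Matrix
open MvPolynomial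
open Literature.NumberTheory.DiophantineGeometry
open Literature.Computability.AlgebraicComplexity
open Literature.Computability.Complexity

noncomputable section

/-! ## Substitutions that respect a fresh padding letter -/

/-- Evaluating at the renamed variables is renaming. [folklore] -/
theorem fp_aeval_X_comp_eq_rename {α τ : Type*} (κ : α → τ) (P : MvPolynomial α ℂ) :
    aeval (fun a => (X (κ a) : MvPolynomial τ ℂ)) P = rename κ P := by
  suffices H : (aeval fun a => (X (κ a) : MvPolynomial τ ℂ)) = rename κ from congrArg (fun φ => φ P) H
  exact MvPolynomial.algHom_ext fun a => by simp

/-- **Acting on the segment while fixing a fresh letter.**  If `y` is off the segment `ι(MatIdx m)`,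
then for every `A ∈ Mat_{m²}` some `B ∈ Mat_{(m+j)²}` has `B · (X_y^j · ι(p)) = X_y^j · ι(A · p)` for
all `p` at once (`B` acts by `A` on the segment copies and fixes `y`). [Mulmuley–Sohoni 2001 §4] -/
theorem exists_linSubst_fresh_padding {m N : ℕ} (hmN : m ≤ N) (y : MatIdx N)
    (hy : ∀ r : MatIdx m, segEmb hmN r ≠ y) (A : Matrix (MatIdx m) (MatIdx m) ℂ) (j : ℕ) :
    ∃ B : Matrix (MatIdx N) (MatIdx N) ℂ, ∀ p : MvPolynomial (MatIdx m) ℂ,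
      linSubst (MatIdx N) ℂ B (X y ^ j * rename (segEmb hmN) p) =
        X y ^ j * rename (segEmb hmN) (linSubst (MatIdx m) ℂ A p) := by
  classical
  have hinj : Function.Injective (segEmb hmN) := (segEmb_strictMono hmN).injective
  let B : Matrix (MatIdx N) (MatIdx N) ℂ := fun s i =>
    if h : ∃ r, segEmb hmN r = i then
      ∑ r' : MatIdx m, (if segEmb hmN r' = s then A r' (Classical.choose h) else 0)
    else if i = y then (if s = y then 1 else 0) else 0
  have hB_seg : ∀ r, linSubst (MatIdx N) ℂ B (X (segEmb hmN r)) =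
      rename (segEmb hmN) (linSubst (MatIdx m) ℂ A (X r)) := by
    intro r
    have hex : ∃ r', segEmb hmN r' = segEmb hmN r := ⟨r, rfl⟩
    have hch : Classical.choose hex = r := hinj (Classical.choose_spec hex)
    rw [linSubst_X, linSubst_X, map_sum]
    simp only [B, dif_pos hex, hch, map_smul, rename_X, Finset.sum_smul, ite_smul, zero_smul]
    rw [Finset.sum_comm]
    refine Finset.sum_congr rfl fun r' _ => ?_
    rw [Finset.sum_ite_eq Finset.univ (segEmb hmN r'), if_pos (Finset.mem_univ _)]
  have hB_y : linSubst (MatIdx N) ℂ B (X y) = X y := by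
    have hnot : ¬ ∃ r, segEmb hmN r = y := fun ⟨r, hr⟩ => hy r hr
    rw [linSubst_X]
    simp only [B, dif_neg hnot, if_true, ite_smul, one_smul, zero_smul]
    rw [Finset.sum_ite_eq' Finset.univ y, if_pos (Finset.mem_univ _)]
  refine ⟨B, fun p => ?_⟩
  have hAp : linSubst (MatIdx m) ℂ A p = aeval (fun a => linSubst (MatIdx m) ℂ A (X a)) p :=
    congrArg (fun φ : MvPolynomial (MatIdx m) ℂ →ₐ[ℂ] MvPolynomial (MatIdx m) ℂ => φ p)
      (MvPolynomial.algHom_ext (fun a => by rw [aeval_X]) :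
        linSubst (MatIdx m) ℂ A = aeval fun a => linSubst (MatIdx m) ℂ A (X a))
  rw [map_mul, map_pow, hB_y, linSubst_rename_eq_aeval, hAp, rename_aeval_eq_aeval]
  congr 1
  exact congrArg (fun G => aeval G p) (funext hB_seg)

/-- **Moving the fresh letter onto the top variable.**  If `y` is off the segment, some `S ∈ Mat_{(m+j)²}`
has `S · (X_y^j · ι(g)) = X_top^j · ι(g) = paddedForm m j g` for all `g` (`y ↦ X_top`, all other
variables fixed; the segment copies are untouched because `y` is not among them). [Mulmuley–Sohoni 2001 §4] -/
theorem exists_linSubst_fresh_to_top {m j : ℕ} [NeZero (m + j)] (y : MatIdx (m + j))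
    (hy : ∀ r : MatIdx m, segEmb (Nat.le_add_right m j) r ≠ y) :
    ∃ S : Matrix (MatIdx (m + j)) (MatIdx (m + j)) ℂ, ∀ g : MvPolynomial (MatIdx m) ℂ,
      linSubst (MatIdx (m + j)) ℂ S (X y ^ j * rename (segEmb (Nat.le_add_right m j)) g) = paddedForm m j g := by
  classical
  let S : Matrix (MatIdx (m + j)) (MatIdx (m + j)) ℂ := fun s i =>
    if i = y then (if s = topMatIdx (m + j) then 1 else 0) else (if s = i then 1 else 0)
  have hS_y : linSubst (MatIdx (m + j)) ℂ S (X y) = X (topMatIdx (m + j)) := by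
    rw [linSubst_X]
    simp only [S, if_true, ite_smul, one_smul, zero_smul]
    rw [Finset.sum_ite_eq' Finset.univ (topMatIdx (m + j)), if_pos (Finset.mem_univ _)]
  have hS_ne : ∀ i, i ≠ y → linSubst (MatIdx (m + j)) ℂ S (X i) = X i := by
    intro i hi
    rw [linSubst_X]
    simp only [S, if_neg hi, ite_smul, one_smul, zero_smul]
    rw [Finset.sum_ite_eq' Finset.univ i, if_pos (Finset.mem_univ _)]
  refine ⟨S, fun g => ?_⟩
  rw [map_mul, map_pow, hS_y, paddedForm, linSubst_rename_eq_aeval]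
  congr 1
  have h77 : ∀ r : MatIdx m, linSubst (MatIdx (m + j)) ℂ S (X (segEmb (Nat.le_add_right m j) r)) =
      X (segEmb (Nat.le_add_right m j) r) := fun r => hS_ne (segEmb (Nat.le_add_right m j) r) (hy r)
  have hom : (aeval fun a => linSubst (MatIdx (m + j)) ℂ S (X (segEmb (Nat.le_add_right m j) a))) =
      rename (segEmb (Nat.le_add_right m j)) :=
    MvPolynomial.algHom_ext fun r => by simp only [aeval_X, rename_X, h77]
  exact congrArg (fun φ : MvPolynomial (MatIdx m) ℂ →ₐ[ℂ] MvPolynomial (MatIdx (m + j)) ℂ => φ g) hom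

/-- For `j ≥ 1` the variable `X₀₀` of level `m + j` lies OFF the final segment of length `m²`
(the segment occupies the last `m²` of the `(m+j)² > m²` lexicographic positions). [folklore] -/
theorem toLex_zero_not_mem_segEmb {m j : ℕ} [NeZero (m + j)] (hj : 1 ≤ j) (r : MatIdx m) :
    segEmb (Nat.le_add_right m j) r ≠ toLex ((0 : Fin (m + j)), (0 : Fin (m + j))) := by
  intro h
  have h1 := congrArg (fun x : MatIdx (m + j) => (((matIdxEquiv (m + j)).symm x : Fin ((m + j) * (m + j))) : ℕ)) h
  simp only [matIdxEquiv_symm_segEmb] at h1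
  have h0 : (((matIdxEquiv (m + j)).symm (toLex ((0 : Fin (m + j)), (0 : Fin (m + j)))) : Fin ((m + j) * (m + j))) : ℕ) = 0 := by
    have : (matIdxEquiv (m + j)) ⟨0, Nat.pos_of_ne_zero (mul_ne_zero (NeZero.ne (m + j)) (NeZero.ne (m + j)))⟩ =
        toLex ((0 : Fin (m + j)), (0 : Fin (m + j))) := by
      rw [matIdxEquiv_apply]
      simp [finProdFinEquiv_symm_apply, Fin.divNat, Fin.modNat]
    rw [← this, OrderIso.symm_apply_apply]
  rw [h0] at h1
  have h2 : m * m < (m + j) * (m + j) := Nat.mul_lt_mul_of_lt_of_le (by omega) (by omega) (by omega)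
  omega

/-- **A fresh letter exists for every positive padding.** [folklore] -/
theorem exists_fresh_of_pos {m j : ℕ} [NeZero (m + j)] (hj : 1 ≤ j) :
    ∃ y : MatIdx (m + j), ∀ r : MatIdx m, segEmb (Nat.le_add_right m j) r ≠ y :=
  ⟨toLex ((0 : Fin (m + j)), (0 : Fin (m + j))), toLex_zero_not_mem_segEmb hj⟩

/-! ## The tool and Problem 6.10 "≥" for fresh letters -/

/-- **Fresh-padding inheritance (the tool).**  Let `p` be a form of degree `m` on `MatIdx m`, `q ≠ 0` a
form of degree `m + j` on `MatIdx (m + j)`, and `y` a variable off the segment with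
`X_y^j · ι(p) ∈ Δ_{m+j}(q)`.  Then for every `λ ⊢ m·δ` with at most `m²` parts,
`mult_{λ*} ℂ[Δ_m(p)] ≤ mult_{(λ♯(m+j))*} ℂ[Δ_{m+j}(q)]`.
Proof: `Δ(q)` is `End`-stable, so it contains `X_y^j · ι(A·p)` (`exists_linSubst_fresh_padding`) and
then `X_top^j · ι(A·p)` (`exists_linSubst_fresh_to_top`) for every `A`; conclude by the every-`j`
transfer along closure points (`orbitMultiplicity_le_rowLift_of_closurePoints`, twist positivity).
[BLMW 2011 §6.4 Problem 6.10; Bürgisser–Ikenmeyer–Panova 2019 §5; this crux] -/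
theorem orbitMultiplicity_le_rowLift_of_fresh_padding_mem {m : ℕ} [NeZero m]
    (p : MvPolynomial (MatIdx m) ℂ) (hp : p.IsHomogeneous m) {δ : ℕ} (lam : Nat.Partition (m * δ))
    (hlam : lam.parts.card ≤ m * m) (j : ℕ) [NeZero (m + j)] (q : MvPolynomial (MatIdx (m + j)) ℂ)
    (hq : q.IsHomogeneous (m + j)) (hq0 : q ≠ 0) (y : MatIdx (m + j))
    (hy : ∀ r : MatIdx m, segEmb (Nat.le_add_right m j) r ≠ y)
    (hmem : X y ^ j * rename (segEmb (Nat.le_add_right m j)) p ∈ orbitClosure q) :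
    orbitMultiplicity ℂ p m (partitionWeightLex m lam) ≤
      orbitMultiplicity ℂ q (m + j) (partitionWeightLex (m + j) (rowLift lam j)) := by
  obtain ⟨S, hS⟩ := exists_linSubst_fresh_to_top (m := m) (j := j) y hy
  refine orbitMultiplicity_le_rowLift_of_closurePoints p hp lam hlam j q hq hq0 fun A => ?_
  obtain ⟨B, hB⟩ := exists_linSubst_fresh_padding (Nat.le_add_right m j) y hy A j
  have h1 : X y ^ j * rename (segEmb (Nat.le_add_right m j)) (linSubst (MatIdx m) ℂ A p) ∈ orbitClosure q := by
    rw [← hB p]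
    exact linSubst_mem_orbitClosure_of_mem hmem B
  rw [← hS (linSubst (MatIdx m) ℂ A p)]
  exact linSubst_mem_orbitClosure_of_mem h1 S

/-- A fresh padding of a nonzero polynomial is nonzero. [folklore] -/
theorem fresh_padding_ne_zero {m j : ℕ} (y : MatIdx (m + j)) {p : MvPolynomial (MatIdx m) ℂ}
    (hp0 : p ≠ 0) : X y ^ j * rename (segEmb (Nat.le_add_right m j)) p ≠ 0 :=
  mul_ne_zero (pow_ne_zero _ (X_ne_zero y))
    ((map_ne_zero_iff _ (rename_injective _ (segEmb_strictMono (Nat.le_add_right m j)).injective)).2 hp0)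

/-- A fresh padding of a form of degree `m` is a form of degree `m + j`. [folklore] -/
theorem isHomogeneous_fresh_padding {m j : ℕ} (y : MatIdx (m + j)) {p : MvPolynomial (MatIdx m) ℂ}
    (hp : p.IsHomogeneous m) : (X y ^ j * rename (segEmb (Nat.le_add_right m j)) p).IsHomogeneous (m + j) := by
  have h := ((isHomogeneous_X ℂ y).pow j).mul (hp.rename_isHomogeneous (f := segEmb (Nat.le_add_right m j)))
  rwa [show 1 * j + m = m + j by ring] at h

/-- **BLMW 2011 Problem 6.10 "≥" for FRESH letters, every form, every step.**  For a nonzero form `p`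
of degree `m` on `MatIdx m`, every `j`, every variable `y` of level `m + j` off the segment, and every
`λ ⊢ m·δ` with at most `m²` parts:
`mult_{λ*} ℂ[Δ_m(p)] ≤ mult_{(λ♯(m+j))*} ℂ[Δ_{m+j}(X_y^j · ι(p))]`.
Padding by a letter that does not occur in `p` never loses an isotypic component, at any single step
and from any (padded or unpadded) start; the same-letter step `x^j g ↦ x^{j+1} g` can
(`padding_step_monotonicity_fails`, `Δ(x^{j+1} g) ⊊ Δ(x^j · w · g)`).  This is Theorem A of
`Cruxes/ValuativeFlip/TwistPositivityK12G1.md` as a single statement.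
[BLMW 2011 §6.4 Problem 6.10; Kadish–Landsberg 2014 §2; Bürgisser–Ikenmeyer–Panova 2019 §1(a), §5] -/
theorem orbitMultiplicity_le_rowLift_fresh_padding {m : ℕ} [NeZero m]
    (p : MvPolynomial (MatIdx m) ℂ) (hp : p.IsHomogeneous m) (hp0 : p ≠ 0) {δ : ℕ}
    (lam : Nat.Partition (m * δ)) (hlam : lam.parts.card ≤ m * m) (j : ℕ) [NeZero (m + j)]
    (y : MatIdx (m + j)) (hy : ∀ r : MatIdx m, segEmb (Nat.le_add_right m j) r ≠ y) :
    orbitMultiplicity ℂ p m (partitionWeightLex m lam) ≤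
      orbitMultiplicity ℂ (X y ^ j * rename (segEmb (Nat.le_add_right m j)) p) (m + j)
        (partitionWeightLex (m + j) (rowLift lam j)) :=
  orbitMultiplicity_le_rowLift_of_fresh_padding_mem p hp lam hlam j _ (isHomogeneous_fresh_padding y hp)
    (fresh_padding_ne_zero y hp0) y hy (mem_orbitClosure_self _)

/-- **Fresh padding by `X₀₀`** (the instance with the canonical fresh letter, `j ≥ 1`):
`mult_{λ*} ℂ[Δ_m(p)] ≤ mult_{(λ♯)*} ℂ[Δ_{m+j}(X₀₀^j · ι(p))]`. [this crux] -/
theorem orbitMultiplicity_le_rowLift_X00_padding {m : ℕ} [NeZero m]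
    (p : MvPolynomial (MatIdx m) ℂ) (hp : p.IsHomogeneous m) (hp0 : p ≠ 0) {δ : ℕ}
    (lam : Nat.Partition (m * δ)) (hlam : lam.parts.card ≤ m * m) (j : ℕ) [NeZero (m + j)] (hj : 1 ≤ j) :
    orbitMultiplicity ℂ p m (partitionWeightLex m lam) ≤
      orbitMultiplicity ℂ (X (toLex ((0 : Fin (m + j)), (0 : Fin (m + j)))) ^ j *
          rename (segEmb (Nat.le_add_right m j)) p) (m + j)
        (partitionWeightLex (m + j) (rowLift lam j)) :=
  orbitMultiplicity_le_rowLift_fresh_padding p hp hp0 lam hlam j _ (toLex_zero_not_mem_segEmb hj)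

/-- **Degenerations to a fresh padding transfer multiplicities (closure form of the tool).**  If some
degeneration of `q` is a fresh padding of `p` UP TO the orbit closure — `Δ_{m+j}(q) ⊇ Δ_{m+j}(X_y^j ι(p))`
is implied by `X_y^j ι(p) ∈ Δ(q)` — then `mult_{(λ♯)*} ℂ[Δ(X_y^j ι p)] ≤ mult_{(λ♯)*} ℂ[Δ(q)]`, and the
two inequalities compose.  Stated here as the chain through the intermediate orbit closure, for users
who hold the membership only for a degeneration `q' ∈ Δ(q)` of `q` with `X_y^j ι(p) ∈ Δ(q')`.
[Bläser–Ikenmeyer 2025 §12.4; this crux] -/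
theorem orbitMultiplicity_le_rowLift_of_fresh_padding_mem_of_mem {m : ℕ} [NeZero m]
    (p : MvPolynomial (MatIdx m) ℂ) (hp : p.IsHomogeneous m) {δ : ℕ} (lam : Nat.Partition (m * δ))
    (hlam : lam.parts.card ≤ m * m) (j : ℕ) [NeZero (m + j)] (q q' : MvPolynomial (MatIdx (m + j)) ℂ)
    (hq : q.IsHomogeneous (m + j)) (hq0 : q ≠ 0) (hq' : q' ∈ orbitClosure q) (y : MatIdx (m + j))
    (hy : ∀ r : MatIdx m, segEmb (Nat.le_add_right m j) r ≠ y)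
    (hmem : X y ^ j * rename (segEmb (Nat.le_add_right m j)) p ∈ orbitClosure q') :
    orbitMultiplicity ℂ p m (partitionWeightLex m lam) ≤
      orbitMultiplicity ℂ q (m + j) (partitionWeightLex (m + j) (rowLift lam j)) :=
  orbitMultiplicity_le_rowLift_of_fresh_padding_mem p hp lam hlam j q hq hq0 y hy
    (orbitClosure_subset_of_mem_holds hq' hmem)

end

end Summit.ValiantsHypothesis.ValiantsHypothesis.Theorems.ValuativeFlip
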